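import Mathlib
import Summits.Ventures.HodgeRepro.Tier4.Line1.WittPlane

/-!
# Tier4/Line1/IntegralWitt — LINE L1, rung C7.2a: INTEGRAL WITT for the hermitian plane over a local subring

Blind re-derivation cell `pub-hodge-repro`, Tier 4 (README §9–§10), seat t4-L1-p1 g2 (STATUS.md S13090): the
field-generic core of C7.2 `exists_finset_integral_transitive` (the integral transitivity at almost all places,
proofs/t4/L1/C7-rungs-sig.lean; binder `h72` of the residual lemma `quotient_compact_of_rungs`, Skeleton v0.28 L674).

SETTING.  `F` a field of characteristic `0`, `𝓞 ⊆ F` a valuation subring (the local ring of integers — at a finite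
place `k_v ⊇ 𝓞_v`), the column-picture hermitian-plane data of t4-L1-p3's `Rot.exists_isometry_mulVec_eq`
(WittPlane p670389): `B` symmetric, `Om` with `Om² = -d`, `Omᵀ B = -(B Om)`, the pairing `β(u, v) = u ⬝ᵥ (B *ᵥ v)`.
INTEGRAL HYPOTHESES: `B`, `Om` have entries in `𝓞`; `det B`, `d` are UNITS of `𝓞` (`IsUnitIn`: in `𝓞` with inverse in
`𝓞`); `2⁻¹ ∈ 𝓞`; `x`, `y` integral vectors with `β(x,x) = β(y,y)` a unit.  CONCLUSION (`exists_integral_isometry_mulVec_eq`):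
an `Om`-linear `B`-isometry `h` with INTEGRAL entries and `h x = y`.  Transposed (`exists_integral_isometry_vecMul_eq`)
this is the row convention of typer-2's `unitaryGroup` / p4's `localU`: `γ Ω = Ω γ`, `γ B γᵀ = B`, `x γ = y`.

WHY NO LATTICE THEORY (Jacobowitz 1962 is NOT used).  p3's construction `h = S R S⁻¹` on the adapted basis
`S = (x, Om x, x′, Om x′)` is integral as soon as `x′` is an INTEGRAL vector orthogonal to `x` and `Om x` with UNIT norm
`α′ = β(x′,x′)`: then `det S² · det B = det G = d² α² α′²` is a unit, so `det S` is a unit and `S⁻¹ = (det S)⁻¹ adj S` is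
integral; `c = S⁻¹ y`, `ν = ±c·α′/α` and `R` are integral.  The SAME `x′` serves `x` and `y`, so `R` is an isometry with no
norm-class matching (`Rot.witt_isometry` as stated).  The ONLY input is therefore STEP 1 (`exists_orth_unit`): such an
`x′` exists.  Proof: the integral projection `P z = z − (β(z,x)/α) x − (β(z,Om x)/(dα)) Om x` onto `K = ⟨x, Om x⟩^⊥`
satisfies `β(Pz, Pw) = β(z,w) − β(z,x)β(w,x)/α − β(z,Om x)β(w,Om x)/(dα)`; if `β(Pz,Pz)` were a non-unit for EVERY
integral `z`, polarisation (`2⁻¹ ∈ 𝓞`) would put every `Δ i j = β(Pe_i, Pe_j)` in the maximal ideal `𝔪`, and the matrix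
identity `B = Δ + α⁻¹ aᵀa + (dα)⁻¹ bᵀb` (`a = B x`, `b = B Om x`) reduced to the residue field `𝓞/𝔪` would make `B̄` of rank
`≤ 2`: `B̄ z̄ = 0` for a non-zero `z̄` orthogonal to `ā`, `b̄` (p3's `Rot.exists_orth_ne_zero` over the residue field), so
`det B̄ = 0`, i.e. `det B ∈ 𝔪` — against `det B` a unit.  No anisotropy, no `¬ IsSquare (-d)`, no split / non-split
case distinction: the statement is uniform at every place where the data are units.

Nothing here says anything about the status of the Hodge conjecture for CM abelian varieties, which is NOT proved
(HC_CM is NOT proved by anyone in this repository).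
-/

set_option autoImplicit false

noncomputable section

namespace Summit.Ventures.HodgeRepro.Tier4.Line1.IntWitt

open Matrix

variable {F : Type} [Field F] (𝓞 : ValuationSubring F)

/-! ## Units of the subring, integral vectors and matrices -/

/-- `a` is a unit of the subring `𝓞`: non-zero, in `𝓞`, with inverse in `𝓞`. -/
def IsUnitIn (a : F) : Prop := a ≠ 0 ∧ a ∈ 𝓞 ∧ a⁻¹ ∈ 𝓞

variable {𝓞}

/-- a unit is non-zero. -/
theorem IsUnitIn.ne_zero {a : F} (h : IsUnitIn 𝓞 a) : a ≠ 0 := h.1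

/-- a unit lies in `𝓞`. -/
theorem IsUnitIn.mem {a : F} (h : IsUnitIn 𝓞 a) : a ∈ 𝓞 := h.2.1

/-- the inverse of a unit lies in `𝓞`. -/
theorem IsUnitIn.inv_mem {a : F} (h : IsUnitIn 𝓞 a) : a⁻¹ ∈ 𝓞 := h.2.2

/-- the inverse of a unit is a unit. -/
theorem IsUnitIn.inv {a : F} (h : IsUnitIn 𝓞 a) : IsUnitIn 𝓞 a⁻¹ :=
  ⟨inv_ne_zero h.1, h.2.2, by rw [inv_inv]; exact h.2.1⟩

/-- a product of units is a unit. -/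
theorem IsUnitIn.mul {a b : F} (ha : IsUnitIn 𝓞 a) (hb : IsUnitIn 𝓞 b) : IsUnitIn 𝓞 (a * b) :=
  ⟨mul_ne_zero ha.1 hb.1, mul_mem ha.2.1 hb.2.1, by rw [mul_inv]; exact mul_mem ha.2.2 hb.2.2⟩

/-- a factor of a unit, itself in `𝓞` with its cofactor in `𝓞`, is a unit. -/
theorem IsUnitIn.of_mul_mem {a b : F} (ha : a ∈ 𝓞) (hb : b ∈ 𝓞) (hab : IsUnitIn 𝓞 (a * b)) :
    IsUnitIn 𝓞 a := by
  refine ⟨left_ne_zero_of_mul hab.1, ha, ?_⟩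
  have : a⁻¹ = b * (a * b)⁻¹ := by
    field_simp [left_ne_zero_of_mul hab.1, right_ne_zero_of_mul hab.1]
  rw [this]
  exact mul_mem hb hab.2.2

/-- `1` is a unit. -/
theorem isUnitIn_one : IsUnitIn 𝓞 (1 : F) := ⟨one_ne_zero, one_mem _, by rw [inv_one]; exact one_mem _⟩

/-- the negative of a unit is a unit. -/
theorem IsUnitIn.neg {a : F} (h : IsUnitIn 𝓞 a) : IsUnitIn 𝓞 (-a) :=
  ⟨neg_ne_zero.mpr h.1, neg_mem h.2.1, by rw [inv_neg]; exact neg_mem h.2.2⟩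

/-- a unit of `𝓞` in the sense of `IsUnitIn` is a unit of the ring `𝓞`. -/
theorem IsUnitIn.isUnit {a : F} (h : IsUnitIn 𝓞 a) : IsUnit (⟨a, h.2.1⟩ : 𝓞) := by
  refine isUnit_iff_exists_inv.mpr ⟨⟨a⁻¹, h.2.2⟩, ?_⟩
  ext
  simp [mul_inv_cancel₀ h.1]

/-- a unit of the ring `𝓞` is a unit in the sense of `IsUnitIn`. -/
theorem isUnitIn_of_isUnit {a : 𝓞} (h : IsUnit a) : IsUnitIn 𝓞 (a : F) := by
  obtain ⟨b, hb⟩ := isUnit_iff_exists_inv.mp h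
  have hb' : (a : F) * b = 1 := by
    have := congrArg (fun z : 𝓞 => (z : F)) hb
    simpa using this
  refine ⟨left_ne_zero_of_mul_eq_one hb', a.2, ?_⟩
  rw [inv_eq_of_mul_eq_one_right hb']
  exact b.2

/-- a non-unit of `𝓞` lies in the maximal ideal. -/
theorem mem_maximalIdeal_of_not_isUnitIn {a : F} (ha : a ∈ 𝓞) (h : ¬ IsUnitIn 𝓞 a) :
    (⟨a, ha⟩ : 𝓞) ∈ IsLocalRing.maximalIdeal 𝓞 := by
  rw [IsLocalRing.mem_maximalIdeal, mem_nonunits_iff]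
  intro hu
  exact h (isUnitIn_of_isUnit hu)

/-- the dot product of two integral vectors is integral. -/
theorem dotProduct_mem {u w : Fin 4 → F} (hu : ∀ i, u i ∈ 𝓞) (hw : ∀ i, w i ∈ 𝓞) : u ⬝ᵥ w ∈ 𝓞 :=
  sum_mem fun i _ => mul_mem (hu i) (hw i)

/-- an integral matrix times an integral column vector is integral. -/
theorem mulVec_mem {M : Matrix (Fin 4) (Fin 4) F} {w : Fin 4 → F} (hM : ∀ i j, M i j ∈ 𝓞)
    (hw : ∀ j, w j ∈ 𝓞) (i : Fin 4) : (M *ᵥ w) i ∈ 𝓞 :=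
  dotProduct_mem (hM i) hw

/-- an integral row vector times an integral matrix is integral. -/
theorem vecMul_mem {M : Matrix (Fin 4) (Fin 4) F} {w : Fin 4 → F} (hM : ∀ i j, M i j ∈ 𝓞)
    (hw : ∀ j, w j ∈ 𝓞) (j : Fin 4) : (w ᵥ* M) j ∈ 𝓞 :=
  dotProduct_mem hw fun i => hM i j

/-- a product of integral matrices is integral. -/
theorem mul_mem_mat {M N : Matrix (Fin 4) (Fin 4) F} (hM : ∀ i j, M i j ∈ 𝓞) (hN : ∀ i j, N i j ∈ 𝓞)
    (i j : Fin 4) : (M * N) i j ∈ 𝓞 := by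
  rw [Matrix.mul_apply]
  exact sum_mem fun l _ => mul_mem (hM i l) (hN l j)

/-- the transpose of an integral matrix is integral. -/
theorem transpose_mem {M : Matrix (Fin 4) (Fin 4) F} (hM : ∀ i j, M i j ∈ 𝓞) (i j : Fin 4) :
    Mᵀ i j ∈ 𝓞 := hM j i

/-- the matrix with entries in `𝓞`, as a matrix over the ring `𝓞`. -/
def toSub (M : Matrix (Fin 4) (Fin 4) F) (hM : ∀ i j, M i j ∈ 𝓞) : Matrix (Fin 4) (Fin 4) 𝓞 :=
  Matrix.of fun i j => ⟨M i j, hM i j⟩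

/-- `toSub M` maps back to `M` under the inclusion `𝓞 → F`. -/
theorem toSub_map (M : Matrix (Fin 4) (Fin 4) F) (hM : ∀ i j, M i j ∈ 𝓞) :
    (toSub M hM).map 𝓞.subtype = M := by
  ext i j
  rfl

/-- the determinant of `toSub M` is the determinant of `M`. -/
theorem det_toSub (M : Matrix (Fin 4) (Fin 4) F) (hM : ∀ i j, M i j ∈ 𝓞) :
    ((toSub M hM).det : F) = M.det := by
  have h := 𝓞.subtype.map_det (toSub M hM)
  rw [RingHom.mapMatrix_apply, toSub_map] at h
  exact h

/-- the determinant of an integral matrix is integral. -/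
theorem det_mem {M : Matrix (Fin 4) (Fin 4) F} (hM : ∀ i j, M i j ∈ 𝓞) : M.det ∈ 𝓞 := by
  rw [← det_toSub M hM]
  exact SetLike.coe_mem _

/-- the adjugate of an integral matrix is integral. -/
theorem adjugate_mem {M : Matrix (Fin 4) (Fin 4) F} (hM : ∀ i j, M i j ∈ 𝓞) (i j : Fin 4) :
    M.adjugate i j ∈ 𝓞 := by
  have h := 𝓞.subtype.map_adjugate (toSub M hM)
  rw [RingHom.mapMatrix_apply, RingHom.mapMatrix_apply, toSub_map] at h
  rw [← h]
  exact SetLike.coe_mem _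

/-- the inverse of an integral matrix with unit determinant is integral. -/
theorem inv_mem {M : Matrix (Fin 4) (Fin 4) F} (hM : ∀ i j, M i j ∈ 𝓞) (hdet : IsUnitIn 𝓞 M.det)
    (i j : Fin 4) : M⁻¹ i j ∈ 𝓞 := by
  have hinv : M⁻¹ = M.det⁻¹ • M.adjugate := by
    apply Matrix.inv_eq_right_inv
    rw [Matrix.mul_smul, Matrix.mul_adjugate, smul_smul, inv_mul_cancel₀ hdet.1, one_smul]
  rw [hinv, Matrix.smul_apply, smul_eq_mul]
  exact mul_mem hdet.2.2 (adjugate_mem hM i j)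

/-! ## Step 1 — an integral orthogonal vector of unit norm -/

section Step1

variable [CharZero F]

/-- the polarised quadratic form of the orthogonal projection: `q z = β(Pz, Pz)` expressed through the original
pairings (the identity `β(Pz,Pw) = β(z,w) − β(z,x)β(w,x)/α − β(z,Om x)β(w,Om x)/(dα)`). -/
theorem pair_proj_eq {B Om : Matrix (Fin 4) (Fin 4) F} {d : F} (hB : Bᵀ = B)
    (hherm : Omᵀ * B = -(B * Om)) (hOm : Om * Om = -(d • (1 : Matrix (Fin 4) (Fin 4) F)))
    (hd : d ≠ 0) (x : Fin 4 → F) (hα : x ⬝ᵥ (B *ᵥ x) ≠ 0) (z w : Fin 4 → F) :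
    let P : (Fin 4 → F) → (Fin 4 → F) := fun u =>
      u - (u ⬝ᵥ (B *ᵥ x) / (x ⬝ᵥ (B *ᵥ x))) • x -
        (u ⬝ᵥ (B *ᵥ (Om *ᵥ x)) / (d * (x ⬝ᵥ (B *ᵥ x)))) • (Om *ᵥ x)
    (P z) ⬝ᵥ (B *ᵥ (P w)) = z ⬝ᵥ (B *ᵥ w) -
      (z ⬝ᵥ (B *ᵥ x)) * (w ⬝ᵥ (B *ᵥ x)) / (x ⬝ᵥ (B *ᵥ x)) -
      (z ⬝ᵥ (B *ᵥ (Om *ᵥ x))) * (w ⬝ᵥ (B *ᵥ (Om *ᵥ x))) / (d * (x ⬝ᵥ (B *ᵥ x))) := by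
  intro P
  have hxOx : x ⬝ᵥ (B *ᵥ (Om *ᵥ x)) = 0 := Rot.pair_mulVec_self hB hherm x
  have hOxx : (Om *ᵥ x) ⬝ᵥ (B *ᵥ x) = 0 := by rw [Rot.pair_comm hB]; exact hxOx
  have hOxOx : (Om *ᵥ x) ⬝ᵥ (B *ᵥ (Om *ᵥ x)) = d * (x ⬝ᵥ (B *ᵥ x)) :=
    Rot.pair_mulVec_mulVec hherm hOm x x
  have hxw : x ⬝ᵥ (B *ᵥ w) = w ⬝ᵥ (B *ᵥ x) := Rot.pair_comm hB x w
  have hOxw : (Om *ᵥ x) ⬝ᵥ (B *ᵥ w) = w ⬝ᵥ (B *ᵥ (Om *ᵥ x)) := Rot.pair_comm hB (Om *ᵥ x) w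
  simp only [P, sub_dotProduct, smul_dotProduct, mulVec_sub, mulVec_smul, dotProduct_sub,
    dotProduct_smul, smul_eq_mul, hxOx, hOxx, hOxOx, hxw, hOxw]
  field_simp
  ring

/-- `P z` is orthogonal to `x`. -/
theorem proj_pair_x {B Om : Matrix (Fin 4) (Fin 4) F} {d : F} (hB : Bᵀ = B)
    (hherm : Omᵀ * B = -(B * Om)) (x : Fin 4 → F) (hα : x ⬝ᵥ (B *ᵥ x) ≠ 0) (z : Fin 4 → F) :
    (z - (z ⬝ᵥ (B *ᵥ x) / (x ⬝ᵥ (B *ᵥ x))) • x -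
        (z ⬝ᵥ (B *ᵥ (Om *ᵥ x)) / (d * (x ⬝ᵥ (B *ᵥ x)))) • (Om *ᵥ x)) ⬝ᵥ (B *ᵥ x) = 0 := by
  have hxOx : x ⬝ᵥ (B *ᵥ (Om *ᵥ x)) = 0 := Rot.pair_mulVec_self hB hherm x
  have hOxx : (Om *ᵥ x) ⬝ᵥ (B *ᵥ x) = 0 := by rw [Rot.pair_comm hB]; exact hxOx
  simp only [sub_dotProduct, smul_dotProduct, smul_eq_mul, hOxx, mul_zero, sub_zero]
  field_simp
  ring

/-- `P z` is orthogonal to `Om x`. -/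
theorem proj_pair_Omx {B Om : Matrix (Fin 4) (Fin 4) F} {d : F} (hB : Bᵀ = B)
    (hherm : Omᵀ * B = -(B * Om)) (hOm : Om * Om = -(d • (1 : Matrix (Fin 4) (Fin 4) F)))
    (hd : d ≠ 0) (x : Fin 4 → F) (hα : x ⬝ᵥ (B *ᵥ x) ≠ 0) (z : Fin 4 → F) :
    (z - (z ⬝ᵥ (B *ᵥ x) / (x ⬝ᵥ (B *ᵥ x))) • x -
        (z ⬝ᵥ (B *ᵥ (Om *ᵥ x)) / (d * (x ⬝ᵥ (B *ᵥ x)))) • (Om *ᵥ x)) ⬝ᵥ (B *ᵥ (Om *ᵥ x)) = 0 := by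
  have hxOx : x ⬝ᵥ (B *ᵥ (Om *ᵥ x)) = 0 := Rot.pair_mulVec_self hB hherm x
  have hOxOx : (Om *ᵥ x) ⬝ᵥ (B *ᵥ (Om *ᵥ x)) = d * (x ⬝ᵥ (B *ᵥ x)) :=
    Rot.pair_mulVec_mulVec hherm hOm x x
  simp only [sub_dotProduct, smul_dotProduct, smul_eq_mul, hxOx, hOxOx, mul_zero, sub_zero]
  field_simp
  ring

/-- a `4 × 4` matrix of the form `c · aᵀa + c′ · bᵀb` kills every vector orthogonal to `a` and `b`. -/
theorem mulVec_eq_zero_of_rank_two {K : Type} [CommRing K] (M : Matrix (Fin 4) (Fin 4) K) (c c' : K)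
    (a b z : Fin 4 → K) (hM : ∀ i j, M i j = c * a i * a j + c' * b i * b j) (ha : a ⬝ᵥ z = 0)
    (hb : b ⬝ᵥ z = 0) : M *ᵥ z = 0 := by
  ext i
  simp only [Matrix.mulVec, dotProduct, Pi.zero_apply] at ha hb ⊢
  simp only [hM]
  have h1 : ∑ j, (c * a i * a j + c' * b i * b j) * z j =
      c * a i * (∑ j, a j * z j) + c' * b i * (∑ j, b j * z j) := by
    simp only [Finset.mul_sum, Finset.sum_add_distrib, add_mul, mul_assoc]
  rw [h1, ha, hb]
  ring

/-- STEP 1 — THE INTEGRAL ORTHOGONAL VECTOR OF UNIT NORM (the only lattice-theoretic input of integral Witt): an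
integral `x′` with `β(x′, x) = β(x′, Om x) = 0` and `β(x′, x′)` a unit of `𝓞`.  Proof by contradiction through the
residue field of `𝓞` (see the module docstring). -/
theorem exists_orth_unit {B Om : Matrix (Fin 4) (Fin 4) F} {d : F} (hB : Bᵀ = B)
    (hherm : Omᵀ * B = -(B * Om)) (hOm : Om * Om = -(d • (1 : Matrix (Fin 4) (Fin 4) F)))
    (hBint : ∀ i j, B i j ∈ 𝓞) (hOmint : ∀ i j, Om i j ∈ 𝓞)
    (hdet : IsUnitIn 𝓞 B.det) (hd : IsUnitIn 𝓞 d) (h2 : (2 : F)⁻¹ ∈ 𝓞)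
    {x : Fin 4 → F} (hx : ∀ i, x i ∈ 𝓞) (hα : IsUnitIn 𝓞 (x ⬝ᵥ (B *ᵥ x))) :
    ∃ x' : Fin 4 → F, (∀ i, x' i ∈ 𝓞) ∧ x' ⬝ᵥ (B *ᵥ x) = 0 ∧ x' ⬝ᵥ (B *ᵥ (Om *ᵥ x)) = 0 ∧
      IsUnitIn 𝓞 (x' ⬝ᵥ (B *ᵥ x')) := by
  have hα0 : x ⬝ᵥ (B *ᵥ x) ≠ 0 := hα.ne_zero
  have hd0 : d ≠ 0 := hd.ne_zero
  have hdα : IsUnitIn 𝓞 (d * (x ⬝ᵥ (B *ᵥ x))) := hd.mul hα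
  have ha_mem : ∀ i, (B *ᵥ x) i ∈ 𝓞 := fun i => mulVec_mem hBint hx i
  have hOx_mem : ∀ i, (Om *ᵥ x) i ∈ 𝓞 := fun i => mulVec_mem hOmint hx i
  have hb_mem : ∀ i, (B *ᵥ (Om *ᵥ x)) i ∈ 𝓞 := fun i => mulVec_mem hBint hOx_mem i
  -- the projection onto the orthogonal complement of `x, Om x`
  let P : (Fin 4 → F) → (Fin 4 → F) := fun u =>
    u - (u ⬝ᵥ (B *ᵥ x) / (x ⬝ᵥ (B *ᵥ x))) • x -
      (u ⬝ᵥ (B *ᵥ (Om *ᵥ x)) / (d * (x ⬝ᵥ (B *ᵥ x)))) • (Om *ᵥ x)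
  have hP_mem : ∀ u : Fin 4 → F, (∀ i, u i ∈ 𝓞) → ∀ i, P u i ∈ 𝓞 := by
    intro u hu i
    simp only [P, Pi.sub_apply, Pi.smul_apply, smul_eq_mul, div_eq_mul_inv]
    exact sub_mem (sub_mem (hu i) (mul_mem (mul_mem (dotProduct_mem hu ha_mem) hα.inv_mem) (hx i)))
      (mul_mem (mul_mem (dotProduct_mem hu hb_mem) hdα.inv_mem) (hOx_mem i))
  have hq : ∀ u : Fin 4 → F, (P u) ⬝ᵥ (B *ᵥ (P u)) = u ⬝ᵥ (B *ᵥ u) -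
      (u ⬝ᵥ (B *ᵥ x)) * (u ⬝ᵥ (B *ᵥ x)) / (x ⬝ᵥ (B *ᵥ x)) -
      (u ⬝ᵥ (B *ᵥ (Om *ᵥ x))) * (u ⬝ᵥ (B *ᵥ (Om *ᵥ x))) / (d * (x ⬝ᵥ (B *ᵥ x))) :=
    fun u => pair_proj_eq hB hherm hOm hd0 x hα0 u u
  have hq_mem : ∀ u : Fin 4 → F, (∀ i, u i ∈ 𝓞) → (P u) ⬝ᵥ (B *ᵥ (P u)) ∈ 𝓞 := fun u hu =>
    dotProduct_mem (hP_mem u hu) (fun i => mulVec_mem hBint (hP_mem u hu) i)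
  by_contra hcon
  have hnon : ∀ u : Fin 4 → F, (∀ i, u i ∈ 𝓞) → ¬ IsUnitIn 𝓞 ((P u) ⬝ᵥ (B *ᵥ (P u))) := fun u hu hunit =>
    hcon ⟨P u, hP_mem u hu, proj_pair_x hB hherm x hα0 u, proj_pair_Omx hB hherm hOm hd0 x hα0 u, hunit⟩
  -- the standard basis vectors and the polarisation
  have he_mem : ∀ i : Fin 4, ∀ j, (Pi.single i (1 : F) : Fin 4 → F) j ∈ 𝓞 := by
    intro i j
    by_cases hij : j = i
    · subst hij; simp
    · simp [hij]
  have hee_mem : ∀ i j : Fin 4, ∀ l, (Pi.single i (1 : F) + Pi.single j (1 : F) : Fin 4 → F) l ∈ 𝓞 :=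
    fun i j l => add_mem (he_mem i l) (he_mem j l)
  have hBsymm : ∀ i j, B j i = B i j := fun i j => by
    have := congrFun (congrFun hB i) j
    rw [Matrix.transpose_apply] at this
    exact this
  -- the defect matrix `Δ i j = B i j − a i a j / α − b i b j / (dα)` and its polarisation identity
  have hΔ : ∀ i j : Fin 4, B i j - (B *ᵥ x) i * (B *ᵥ x) j / (x ⬝ᵥ (B *ᵥ x)) -
      (B *ᵥ (Om *ᵥ x)) i * (B *ᵥ (Om *ᵥ x)) j / (d * (x ⬝ᵥ (B *ᵥ x))) =
      (2 : F)⁻¹ * ((P (Pi.single i 1 + Pi.single j 1)) ⬝ᵥ (B *ᵥ (P (Pi.single i 1 + Pi.single j 1))) -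
        (P (Pi.single i 1)) ⬝ᵥ (B *ᵥ (P (Pi.single i 1))) -
        (P (Pi.single j 1)) ⬝ᵥ (B *ᵥ (P (Pi.single j 1)))) := by
    intro i j
    rw [hq, hq, hq]
    simp only [add_dotProduct, mulVec_add, dotProduct_add, single_dotProduct, one_mul,
      mulVec_single_one, Matrix.col_apply]
    rw [hBsymm i j]
    field_simp
    ring
  have hΔ_mem : ∀ i j : Fin 4, B i j - (B *ᵥ x) i * (B *ᵥ x) j / (x ⬝ᵥ (B *ᵥ x)) -
      (B *ᵥ (Om *ᵥ x)) i * (B *ᵥ (Om *ᵥ x)) j / (d * (x ⬝ᵥ (B *ᵥ x))) ∈ 𝓞 := by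
    intro i j
    rw [hΔ i j]
    exact mul_mem h2 (sub_mem (sub_mem (hq_mem _ (hee_mem i j)) (hq_mem _ (he_mem i))) (hq_mem _ (he_mem j)))
  -- everything over the ring `𝓞`
  let ρ := IsLocalRing.residue 𝓞
  let B₀ : Matrix (Fin 4) (Fin 4) 𝓞 := toSub B hBint
  let Om₀ : Matrix (Fin 4) (Fin 4) 𝓞 := toSub Om hOmint
  let x₀ : Fin 4 → 𝓞 := fun i => ⟨x i, hx i⟩
  let a₀ : Fin 4 → 𝓞 := B₀ *ᵥ x₀
  let b₀ : Fin 4 → 𝓞 := B₀ *ᵥ (Om₀ *ᵥ x₀)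
  let αi₀ : 𝓞 := ⟨(x ⬝ᵥ (B *ᵥ x))⁻¹, hα.inv_mem⟩
  let dαi₀ : 𝓞 := ⟨(d * (x ⬝ᵥ (B *ᵥ x)))⁻¹, hdα.inv_mem⟩
  let Δ₀ : Matrix (Fin 4) (Fin 4) 𝓞 := Matrix.of fun i j =>
    ⟨B i j - (B *ᵥ x) i * (B *ᵥ x) j / (x ⬝ᵥ (B *ᵥ x)) -
      (B *ᵥ (Om *ᵥ x)) i * (B *ᵥ (Om *ᵥ x)) j / (d * (x ⬝ᵥ (B *ᵥ x))), hΔ_mem i j⟩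
  have hx₀ : (fun i => (x₀ i : F)) = x := funext fun i => rfl
  have ha₀ : ∀ i, (a₀ i : F) = (B *ᵥ x) i := by
    intro i
    have h := RingHom.map_mulVec 𝓞.subtype B₀ x₀ i
    rw [toSub_map] at h
    exact h
  have hOx₀ : ∀ i, ((Om₀ *ᵥ x₀) i : F) = (Om *ᵥ x) i := by
    intro i
    have h := RingHom.map_mulVec 𝓞.subtype Om₀ x₀ i
    rw [toSub_map] at h
    exact h
  have hb₀ : ∀ i, (b₀ i : F) = (B *ᵥ (Om *ᵥ x)) i := by
    intro i
    have h := RingHom.map_mulVec 𝓞.subtype B₀ (Om₀ *ᵥ x₀) i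
    rw [toSub_map] at h
    show 𝓞.subtype ((B₀ *ᵥ (Om₀ *ᵥ x₀)) i) = _
    rw [h]
    congr 1
  -- the matrix identity in `𝓞`
  have hident : ∀ i j, B₀ i j = Δ₀ i j + αi₀ * a₀ i * a₀ j + dαi₀ * b₀ i * b₀ j := by
    intro i j
    apply Subtype.ext
    show 𝓞.subtype (B₀ i j) = 𝓞.subtype (Δ₀ i j + αi₀ * a₀ i * a₀ j + dαi₀ * b₀ i * b₀ j)
    rw [map_add, map_add, map_mul, map_mul, map_mul, map_mul]
    simp only [ValuationSubring.subtype_apply]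
    rw [ha₀, ha₀, hb₀, hb₀]
    simp only [B₀, toSub, Δ₀, Matrix.of_apply, αi₀, dαi₀]
    field_simp
    ring
  -- the defect lies in the maximal ideal
  have hΔ₀ : ∀ i j, ρ (Δ₀ i j) = 0 := by
    intro i j
    rw [IsLocalRing.residue_eq_zero_iff]
    have hform : Δ₀ i j = (⟨(2 : F)⁻¹, h2⟩ : 𝓞) *
        ((⟨_, hq_mem _ (hee_mem i j)⟩ : 𝓞) - ⟨_, hq_mem _ (he_mem i)⟩ - ⟨_, hq_mem _ (he_mem j)⟩) := by
      apply Subtype.ext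
      show 𝓞.subtype (Δ₀ i j) = 𝓞.subtype (_ * (_ - _ - _))
      rw [map_mul, map_sub, map_sub]
      simp only [ValuationSubring.subtype_apply, Δ₀, Matrix.of_apply]
      exact hΔ i j
    rw [hform]
    exact Ideal.mul_mem_left _ _ (Ideal.sub_mem _ (Ideal.sub_mem _
      (mem_maximalIdeal_of_not_isUnitIn _ (hnon _ (hee_mem i j)))
      (mem_maximalIdeal_of_not_isUnitIn _ (hnon _ (he_mem i))))
      (mem_maximalIdeal_of_not_isUnitIn _ (hnon _ (he_mem j))))
  -- over the residue field: `B̄` has rank `≤ 2`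
  have hident' : ∀ i j, (B₀.map ρ) i j = ρ αi₀ * (ρ ∘ a₀) i * (ρ ∘ a₀) j + ρ dαi₀ * (ρ ∘ b₀) i * (ρ ∘ b₀) j := by
    intro i j
    simp only [Matrix.map_apply, Function.comp]
    rw [hident i j, map_add, map_add, hΔ₀, zero_add, map_mul, map_mul, map_mul, map_mul]
  obtain ⟨z, hz, hz1, hz2⟩ := Rot.exists_orth_ne_zero (B₀.map ρ) (Om₀.map ρ) (ρ ∘ x₀)
  have hρa : ρ ∘ a₀ = (B₀.map ρ) *ᵥ (ρ ∘ x₀) := by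
    funext i
    exact RingHom.map_mulVec ρ B₀ x₀ i
  have hρOx : ρ ∘ (Om₀ *ᵥ x₀) = (Om₀.map ρ) *ᵥ (ρ ∘ x₀) := by
    funext i
    exact RingHom.map_mulVec ρ Om₀ x₀ i
  have hρb : ρ ∘ b₀ = (B₀.map ρ) *ᵥ ((Om₀.map ρ) *ᵥ (ρ ∘ x₀)) := by
    funext i
    rw [← hρOx]
    exact RingHom.map_mulVec ρ B₀ (Om₀ *ᵥ x₀) i
  have hz1' : (ρ ∘ a₀) ⬝ᵥ z = 0 := by
    rw [dotProduct_comm, hρa]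
    exact hz1
  have hz2' : (ρ ∘ b₀) ⬝ᵥ z = 0 := by
    rw [dotProduct_comm, hρb]
    exact hz2
  have hBz : (B₀.map ρ) *ᵥ z = 0 :=
    mulVec_eq_zero_of_rank_two (B₀.map ρ) (ρ αi₀) (ρ dαi₀) (ρ ∘ a₀) (ρ ∘ b₀) z hident' hz1' hz2'
  have hdet0 : (B₀.map ρ).det = 0 := Matrix.exists_mulVec_eq_zero_iff.mp ⟨z, hz, hBz⟩
  have hdetρ : ρ B₀.det = 0 := by
    rw [RingHom.map_det, RingHom.mapMatrix_apply]
    exact hdet0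
  rw [IsLocalRing.residue_eq_zero_iff, IsLocalRing.mem_maximalIdeal, mem_nonunits_iff] at hdetρ
  apply hdetρ
  have hB₀det : B₀.det = ⟨B.det, hdet.mem⟩ := Subtype.ext (det_toSub B hBint)
  rw [hB₀det]
  exact hdet.isUnit

end Step1

end Summit.Ventures.HodgeRepro.Tier4.Line1.IntWitt

end
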